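import Mathlib
import HarnessLib.Audit
import Summits.PneNP.PneNP.Theorems.PstarCoupled

/-!
# P★ `h = 2` core bound — the COUPLED residues of O2 WITH THE GATE FOOTPRINT: `CoupledFourG`, `CoupledThreeG` (ROUND-25; planner p3 g23, memo §14.35 (3); statements VERBATIM from `r25/SketchCoupled.lean` v2)

FRONTIER rung F-N3 (`stmt-PneNP-19007`), restricted model P★; nothing here bears on `P ≠ NP`.

`PstarCoupled.CoupledFour` / `PstarCoupled.CoupledThree` (v1, p675047) state the reduced coupled data of memo §14.33 (B) / §14.34 on the
smaller core with "radius slack one" but WITHOUT the fibred-out gate `g₀` as an output of the instance.  The planner's D′-census K22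
(memo §14.35; kit j319854, and this seat's `lit`-mode run j320165) shows that some OR-lift data are `(r,3/2)`-non-expanding ONLY through
output families containing `g₀` (k = 5: 192 of 1728 cross data become expanding once `g₀` is removed; `lit` mode k = 4: 3040 of 137824),
so any proof of the coupled bounds must spend `BoundaryExpanding` on families through `g₀`.  The planner therefore re-typed both nodes
(r25/SketchCoupled.lean v2, 2026-08-28T23:01Z) with the footprint of `g₀` kept: binders `g₀ ∉ J₀`, the AND pair of `g₀` = (the private
of the deleted chord, the coupled literal / the private of the second deleted chord), and the radius `#(J₀ ∪ A.2.1 ∪ w₂.2.1 ∪ {g₀}) ≤ r`.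

This file lands the v2 nodes under new names (the v1 names stay, append-only):
* `CoupledFourG`, `CoupledThreeG` — p3's v2 statements verbatim (only the names changed);
* `coupledFourG_of_coupledFour`, `coupledThreeG_of_coupledThree` — v1 ⟹ v2 (the v2 data are v1 data: `g₀` touches a chord private, so by
  the hun-cleanliness of `A`, `w₂` it is a new output and the radius with `g₀` gives the v1 slack).
The reductions `CoupledFourG → TerminalFiveCotree1Blind` and `CoupledThreeG → TerminalFiveCross1Blind` (the Terminal datum supplies the
footprint of `g₀` for free) are `PstarCotreeCoupledG` / `PstarCrossCoupledG`.
-/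

set_option linter.dupNamespace false -- `Summit.PneNP.PneNP.…`: summit = sub-problem name (D-0017 single-conjunct layout)

open Finset Literature.Computability.Complexity
open Summit.PneNP.PneNP.Theorems.PstarTyped (Typed)
open Summit.PneNP.PneNP.Theorems.PstarSALevel (varSet bdry BoundaryExpanding SimpleOverlap)
open Summit.PneNP.PneNP.Theorems.PstarGapOneAll (gval)
open Summit.PneNP.PneNP.Theorems.PstarCoreBound (XorClosed)
open Summit.PneNP.PneNP.Theorems.PstarChordRepair (IsChord)
open Summit.PneNP.PneNP.Theorems.PstarChordBridgeCotree (Peelable)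
open Summit.PneNP.PneNP.Theorems.PstarChordBridgeTools (privs mem_privs)
open Summit.PneNP.PneNP.Theorems.PstarCoupled (sform CoupledFour CoupledThree)

namespace Summit.PneNP.PneNP.Theorems.PstarCoupledG

variable {n m : ℕ}

/-! ## The reduced COUPLED data with the footprint of the gate (memo §14.33 (B), §14.34, §14.35 (3)) -/

/-- **TARGET (OPEN): the COTREE-COUPLED datum bounds the core (`#J₀ ≤ 5`, i.e. `#(J₀ ∖ e) ≤ 4`).**  `J₀` a terminal-shaped core (XOR-closed, `#J₀ < r`,
admissible `F`, chords), `e ∈ J₀ ∖ F` the DELETED chord, `A`, `w₂` clean G-constraints not mentioning the privates of `e`, with radius slack one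
(the fibred-out gate `g₀`, which stays in the radius: some OR-lift data are non-expanding only through sets containing `g₀` — census K22), `u` an AND-input of a cotree edge with literal polarity `pol`; on `J₀ ∖ e`: (i) `Sol ∩ {w₂ = t₂} ⊆ {A = a} ∩ {ℓ_u ⟹ s_e}`,
(ii) minimally in every `f ∈ J₀ ∖ e`, (iii) `ℓ_u = 1` and `s_e = 0` are each met on `Sol ∩ {w₂ = t₂}`.  FRONTIER. -/
@[conjecture] def CoupledFourG : Prop :=
  ∀ (n m r : ℕ) (I : LocalMap 4 n m), I.IsPure xorAndPred → Typed I → SimpleOverlap I → BoundaryExpanding r I →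
  ∀ (y : Fin m → Bool) (J₀ F : Finset (Fin m)) (e g₀ : Fin m) (A w₂ : Finset (Fin n) × Finset (Fin m) × Bool) (u : Fin n) (pol : Bool),
    XorClosed I J₀ → J₀.card < r → Disjoint J₀ A.2.1 → Disjoint J₀ w₂.2.1 → g₀ ∉ J₀ → (J₀ ∪ A.2.1 ∪ w₂.2.1 ∪ {g₀}).card ≤ r →
    F ⊆ J₀ → Peelable I F → (∀ F', F ⊆ F' → F' ⊆ J₀ → Peelable I F' → F' = F) → (∀ e' ∈ J₀ \ F, IsChord I J₀ e') →
    e ∈ J₀ \ F → (∃ j₀ ∈ F, u = I.vars j₀ 2 ∨ u = I.vars j₀ 3) →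
    -- the fibred-out cross gate `g₀ = x_p · x_u` keeps its footprint in the expansion radius (`p` a private of `e`)
    ((I.vars g₀ 2 = I.vars e 2 ∨ I.vars g₀ 2 = I.vars e 3) ∧ I.vars g₀ 3 = u ∨ (I.vars g₀ 3 = I.vars e 2 ∨ I.vars g₀ 3 = I.vars e 3) ∧ I.vars g₀ 2 = u) →
    (∀ g ∈ A.2.1 ∪ w₂.2.1, ∀ v ∈ privs I (J₀ \ F), I.vars g 2 ≠ v ∧ I.vars g 3 ≠ v) →
    I.vars e 2 ∉ A.1 → I.vars e 3 ∉ A.1 → I.vars e 2 ∉ w₂.1 → I.vars e 3 ∉ w₂.1 →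
    -- (i) implication + coupling on `J₀ ∖ e`
    (∀ x, (∀ j ∈ J₀.erase e, I.eval x j = y j) → gval I w₂.1 w₂.2.1 x = w₂.2.2 →
      gval I A.1 A.2.1 x = A.2.2 ∧ (xor (x u) pol = true → sform I y e x = true)) →
    -- (ii) minimality
    (∀ f ∈ J₀.erase e, ∃ x, (∀ j ∈ (J₀.erase e).erase f, I.eval x j = y j) ∧ gval I w₂.1 w₂.2.1 x = w₂.2.2 ∧
      ¬ (gval I A.1 A.2.1 x = A.2.2 ∧ (xor (x u) pol = true → sform I y e x = true))) →
    -- (iii) the literal is on somewhere, the path-sum is off somewhere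
    (∃ x, (∀ j ∈ J₀.erase e, I.eval x j = y j) ∧ gval I w₂.1 w₂.2.1 x = w₂.2.2 ∧ xor (x u) pol = true) →
    (∃ x, (∀ j ∈ J₀.erase e, I.eval x j = y j) ∧ gval I w₂.1 w₂.2.1 x = w₂.2.2 ∧ sform I y e x = false) →
    J₀.card ≤ 5

/-- **TARGET (OPEN): the NOR-COUPLED datum of two deleted chords bounds the core (`#J₀ ≤ 5`, i.e. `#(J₀ ∖ {e_p, e_q}) ≤ 3`).**  As `CoupledFour` with two
distinct deleted chords and the coupling `s_{e_p} ∨ s_{e_q}` (no corner); (iii): each of `s_{e_p} = 0`, `s_{e_q} = 0` is met.  FRONTIER. -/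
@[conjecture] def CoupledThreeG : Prop :=
  ∀ (n m r : ℕ) (I : LocalMap 4 n m), I.IsPure xorAndPred → Typed I → SimpleOverlap I → BoundaryExpanding r I →
  ∀ (y : Fin m → Bool) (J₀ F : Finset (Fin m)) (e₁ e₂ g₀ : Fin m) (A w₂ : Finset (Fin n) × Finset (Fin m) × Bool),
    XorClosed I J₀ → J₀.card < r → Disjoint J₀ A.2.1 → Disjoint J₀ w₂.2.1 → g₀ ∉ J₀ → (J₀ ∪ A.2.1 ∪ w₂.2.1 ∪ {g₀}).card ≤ r →
    F ⊆ J₀ → Peelable I F → (∀ F', F ⊆ F' → F' ⊆ J₀ → Peelable I F' → F' = F) → (∀ e' ∈ J₀ \ F, IsChord I J₀ e') →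
    e₁ ∈ J₀ \ F → e₂ ∈ J₀ \ F → e₁ ≠ e₂ →
    -- the fibred-out cross gate `g₀ = x_p · x_q` keeps its footprint in the expansion radius (`p`, `q` privates of `e₁`, `e₂`)
    (I.vars g₀ 2 = I.vars e₁ 2 ∨ I.vars g₀ 2 = I.vars e₁ 3) → (I.vars g₀ 3 = I.vars e₂ 2 ∨ I.vars g₀ 3 = I.vars e₂ 3) →
    (∀ g ∈ A.2.1 ∪ w₂.2.1, ∀ v ∈ privs I (J₀ \ F), I.vars g 2 ≠ v ∧ I.vars g 3 ≠ v) →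
    (∀ e ∈ ({e₁, e₂} : Finset (Fin m)), I.vars e 2 ∉ A.1 ∧ I.vars e 3 ∉ A.1 ∧ I.vars e 2 ∉ w₂.1 ∧ I.vars e 3 ∉ w₂.1) →
    (∀ x, (∀ j ∈ (J₀.erase e₁).erase e₂, I.eval x j = y j) → gval I w₂.1 w₂.2.1 x = w₂.2.2 →
      gval I A.1 A.2.1 x = A.2.2 ∧ (sform I y e₁ x = true ∨ sform I y e₂ x = true)) →
    (∀ f ∈ (J₀.erase e₁).erase e₂, ∃ x, (∀ j ∈ ((J₀.erase e₁).erase e₂).erase f, I.eval x j = y j) ∧ gval I w₂.1 w₂.2.1 x = w₂.2.2 ∧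
      ¬ (gval I A.1 A.2.1 x = A.2.2 ∧ (sform I y e₁ x = true ∨ sform I y e₂ x = true))) →
    (∃ x, (∀ j ∈ (J₀.erase e₁).erase e₂, I.eval x j = y j) ∧ gval I w₂.1 w₂.2.1 x = w₂.2.2 ∧ sform I y e₁ x = false) →
    (∃ x, (∀ j ∈ (J₀.erase e₁).erase e₂, I.eval x j = y j) ∧ gval I w₂.1 w₂.2.1 x = w₂.2.2 ∧ sform I y e₂ x = false) →
    J₀.card ≤ 5

/-! ## v1 ⟹ v2 -/

/-- A monomial touching a private of a chord off `F` is none of the hun-clean monomials. -/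
theorem not_mem_of_touch (I : LocalMap 4 n m) {J₀ F G : Finset (Fin m)} {g₀ : Fin m} {s : Fin 4} (hs : s = 2 ∨ s = 3)
    (hpriv : I.vars g₀ s ∈ privs I (J₀ \ F)) (hun : ∀ g ∈ G, ∀ v ∈ privs I (J₀ \ F), I.vars g 2 ≠ v ∧ I.vars g 3 ≠ v) : g₀ ∉ G := by
  intro hg
  rcases hs with rfl | rfl
  · exact (hun g₀ hg _ hpriv).1 rfl
  · exact (hun g₀ hg _ hpriv).2 rfl

/-- The radius with the footprint of a NEW output `g₀` gives radius slack one without it. -/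
theorem card_lt_of_footprint {J₀ A W : Finset (Fin m)} {g₀ : Fin m} {r : ℕ} (hJ : g₀ ∉ J₀) (hA : g₀ ∉ A) (hW : g₀ ∉ W)
    (h : (J₀ ∪ A ∪ W ∪ {g₀}).card ≤ r) : (J₀ ∪ A ∪ W).card < r := by
  have hg : g₀ ∉ J₀ ∪ A ∪ W := by
    intro h'
    rcases mem_union.1 h' with h' | h'
    · rcases mem_union.1 h' with h' | h'
      · exact hJ h'
      · exact hA h'
    · exact hW h'
  have hc : (J₀ ∪ A ∪ W ∪ {g₀}).card = (J₀ ∪ A ∪ W).card + 1 := by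
    rw [union_comm _ ({g₀} : Finset (Fin m)), singleton_union, card_insert_of_notMem hg]
  omega

/-- **v1 ⟹ v2 for the cotree datum**: `PstarCoupled.CoupledFour → CoupledFourG`. -/
theorem coupledFourG_of_coupledFour (h : CoupledFour) : CoupledFourG := by
  intro n m r I hI hT hS hB y J₀ F e g₀ A w₂ u pol hX hJr hdA hdW hg₀ hrad hF hP hmax hch he hu hfoot hun hA2 hA3 hW2 hW3 hi hii hon hoff
  -- the private slot of `g₀` is a private of `e ∈ J₀ ∖ F`, so `g₀` is none of the clean monomials
  have hpe : ∀ {v : Fin n}, (v = I.vars e 2 ∨ v = I.vars e 3) → v ∈ privs I (J₀ \ F) := by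
    rintro v (rfl | rfl)
    · exact (mem_privs I).2 ⟨e, he, Or.inl rfl⟩
    · exact (mem_privs I).2 ⟨e, he, Or.inr rfl⟩
  have hg₀AW : g₀ ∉ A.2.1 ∪ w₂.2.1 := by
    rcases hfoot with ⟨h2, -⟩ | ⟨h3, -⟩
    · exact not_mem_of_touch I (Or.inl rfl) (hpe h2) hun
    · exact not_mem_of_touch I (Or.inr rfl) (hpe h3) hun
  have hA : g₀ ∉ A.2.1 := fun h' => hg₀AW (mem_union_left _ h')
  have hW : g₀ ∉ w₂.2.1 := fun h' => hg₀AW (mem_union_right _ h')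
  exact h n m r I hI hT hS hB y J₀ F e A w₂ u pol hX hJr hdA hdW (card_lt_of_footprint hg₀ hA hW hrad) hF hP hmax hch he hu hun hA2 hA3
    hW2 hW3 hi hii hon hoff

/-- **v1 ⟹ v2 for the cross datum**: `PstarCoupled.CoupledThree → CoupledThreeG`. -/
theorem coupledThreeG_of_coupledThree (h : CoupledThree) : CoupledThreeG := by
  intro n m r I hI hT hS hB y J₀ F e₁ e₂ g₀ A w₂ hX hJr hdA hdW hg₀ hrad hF hP hmax hch he₁ he₂ hne h2 h3 hun hbl hi hii hoff₁ hoff₂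
  have hp : I.vars g₀ 2 ∈ privs I (J₀ \ F) := by
    rcases h2 with h2 | h2
    · exact (mem_privs I).2 ⟨e₁, he₁, Or.inl h2.symm⟩
    · exact (mem_privs I).2 ⟨e₁, he₁, Or.inr h2.symm⟩
  have hg₀AW : g₀ ∉ A.2.1 ∪ w₂.2.1 := not_mem_of_touch I (Or.inl rfl) hp hun
  have hA : g₀ ∉ A.2.1 := fun h' => hg₀AW (mem_union_left _ h')
  have hW : g₀ ∉ w₂.2.1 := fun h' => hg₀AW (mem_union_right _ h')
  exact h n m r I hI hT hS hB y J₀ F e₁ e₂ A w₂ hX hJr hdA hdW (card_lt_of_footprint hg₀ hA hW hrad) hF hP hmax hch he₁ he₂ hne hun hbl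
    hi hii hoff₁ hoff₂

end Summit.PneNP.PneNP.Theorems.PstarCoupledG
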